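import Summits.QuantumFields.BalabanUV.Beta.EriceRemainderEnclosureHistoryAutonomyComparisonNonlinearLight

/-!
# EriceRemainderEnclosureHistoryAutonomyComparisonNonlinearVariationBase — (E121b) companion of (E121a) `…NonlinearVariationPrep` (the damping defect of a steep excess priced by
# the excess variation along the orbit: `δ_k − δ_{k+1} ≤ (F(m) + e_m·h_m²)·δ_k` given the variation bound `Σ_{j<J} h_{m+j}²·Δe_{m+j} ≤ X_m·h_m²` at the deeper row).  Base
# `B u = β₀ + Σ_{k<K} L_k·u_k` (`β₀ > 0`, `L ≥ 0`, `L_0 = 0`; profile, range, sizes ARBITRARY); `B′ ≥ B` with an ISOTONE excess `E` of ANY steepness; base orbit `h = S y`,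
# `e_m = E(S′h_m)`, `X_m = B′(S′h_m) − B(S h_m)`, `u_m = Δa_m∕a_{m+1}`, `T(m) = Σ_k k·L_kh_{m+k}³∕2`.  HERE: (§3) **`defect_size_le`** — the extra defect `e·h²` (EXCESS SIZE ×
# LEVEL⁻¹, in place of (E119b)'s `ME·h³∕2`) fits the spare twentieth of the damped budget polynomial ((E119a)) as soon as `e ≤ β₀∕10`, because `(k−1)∕a_{n+1+k} ≤ 1∕β₀`;
# (§4) **`exists_base_depth_var`** — the deep region of (E118c) `exists_base_depth` with, in addition, the FIRST MOMENT small at the pin, `(Σ_k k·L_k)·h_n ≤ 2β₀`; and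
# **`var_base`** — there the variation bound holds for every `J` outright: `X_m ≥ e_m − T(m)·e_{m+1}` ((E119b) `step_ge_excess`) with `T(m) ≤ (Σ_kk·L_k)·h_{m+1}³∕2 ≤
# β₀·h_{m+1}² ≤ u_m`, while `Σ_{j<J} h_{m+j}²·Δe_{m+j} ≤ h_m²·(e_m − u_m·e_{m+1})`.  Sequels: (E121c) the row inequality with the per-age defect as a hypothesis, (E121d) the
# generic gauge step keeping the excess difference, (E121e) COMPARISON AT ANY STEEPNESS FOR EVERY ISOTONE EXCESS OF SIZE `≤ β₀∕10`.

Cell `pub-balaban`, β-function sub-cell, BINDER row D4 «RemainderConst leaves for Bałaban's split» (`HOME/BINDER-OWNERS.md`; owner lineage `b2b-balaban-beta-an4`;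
this file by co-owner #2 lineage `b2b-balaban-beta-d4-p2`, generation 99), β-FLOW TEAM duty (1), FREEZE (0) honoured (def-free; imports (E120c); uses (E118a) `affine_facts`,
(E118c) `exists_base_depth`, (E119b) `excess_orbit_antitone` ∕ `step_ge_excess`, (E48a) `family_mem` ∕ `strictAnti_of_memFlow`, node U2's `invSq_eq_of_memFlow` ∕
`mul_lower_le_drive` BY NAME; `defect_size_le` is (E119b) `defect_mod_le`'s computation re-run; nothing restated).

HONEST FRAMING (page 1, verbatim and binding).  *"Discharging BetaPertH makes Bałaban's UV stability UNCONDITIONAL — a real constructive-QFT result; it is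
NOT the continuum limit and NOT the Clay problem."*  THIS FILE DISCHARGES NOTHING OF THE KIND.  Elementary real analysis about ABSTRACT functionals on a box
]0,γ]^ℕ with displayed floors, moduli, profiles and signs — hypotheses of a census, not facts; the form, signs, ages and moments of Bałaban's (1.22) limit
functional are NOT PRINTED ([I] p. 298; GAPS G-t4-U2-1∕-2) and NOT asserted.  Row D4 class UNCHANGED (critical-path width 0; instance 0∕1; D4 DISCHARGE NO
DATE).  HONEST DEPENDENCY: continuum YM on T⁴ ⇐ BetaPertH ∧ nine spine estimates (0/9 proved); BetaPertH ⇐ (D1) ∧ (D4) ∧ CAP+tail; G-an2-4 gates asym, D1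
and NE2/3/4.  NOT CLAIMED here: the comparison theorem (sequel (E121e)); anything printed — NOT B12 Thm 2, NOT BetaPertH, NOT continuum, NOT Clay.

WHAT IS PROVED ([folklore]; 0 `def`, 0 sorry).  §3 **`defect_size_le`**.  §4 **`exists_base_depth_var`**, **`var_base`**.
-/

noncomputable section
open Finset Set

namespace Summit.QuantumFields.BalabanUV.Beta.EriceRemainderEnclosureHistoryAutonomyComparisonNonlinearVariationBase

open Literature.MathematicalPhysics.QuantumFieldTheory.Balaban1983to89
open Literature.MathematicalPhysics.QuantumFieldTheory.Balaban1983to89.T4BetaStationary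
open Literature.MathematicalPhysics.QuantumFieldTheory.Balaban1983to89.T4BetaFlowWellPosed
open Summit.QuantumFields.BalabanUV.Beta.EriceRemainderEnclosureHistoryAutonomyOrder (family_mem strictAnti_of_memFlow)
open Summit.QuantumFields.BalabanUV.Beta.EriceRemainderEnclosureHistoryAutonomyComparisonNonlinearRowPrep (affine_facts)
open Summit.QuantumFields.BalabanUV.Beta.EriceRemainderEnclosureHistoryAutonomyComparisonNonlinearLevelGaugePrep (exists_base_depth)
open Summit.QuantumFields.BalabanUV.Beta.EriceRemainderEnclosureHistoryAutonomyComparisonNonlinearModulusPrep (excess_orbit_antitone step_ge_excess)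

variable {B B' : (ℕ → ℝ) → ℝ} {γ β₀ M' : ℝ} {L : ℕ → ℝ} {K : ℕ} {S S' : ℝ → ℕ → ℝ}

/-! ## §3 The size defect fits the spare twentieth -/

/-- **THE SIZE DEFECT AT AN AGE `k ≥ 1` IS AT MOST A TWENTIETH OF ITS SHARE**, when the excess size is `e ≤ β₀∕10`: along a box solution `h` of a memory with floor `β₀`
from the pin `y`, with the interior window bounded through the gauge (`0 ≤ S ≤ ε1·h_{n+1}²·Σ_{1≤l<k} a_{n+1+l}`, `ε1 ≥ 0`),
`(L_kh_{n+1+k}³∕2)·(e·h_{n+k+1}²)·S ≤ (1∕20)·L_kh_{n+1+k}·h_{n+1}²·ε1` — every window level is `≤ a_{n+1+k}` and `(k−1)∕a_{n+1+k} ≤ 1∕β₀` since `a_j ≥ j·β₀`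
(cf. (E119b) `defect_mod_le`). [folklore] -/
theorem defect_size_le {h : ℕ → ℝ} {y e : ℝ} (hL : ∀ k, 0 ≤ L k) (hβ : 0 < β₀) (hlo : ∀ u, SeqBox γ u → β₀ ≤ B u)
    (hh : SeqBox γ h) (hf : MemFlow B y h) (he0 : 0 ≤ e) (he : e ≤ β₀ / 10)
    (n : ℕ) {k : ℕ} (hk : 1 ≤ k) {S ε1 : ℝ} (hε1 : 0 ≤ ε1) (hS : S ≤ ε1 * h (n + 1) ^ 2 * ∑ l ∈ Ico 1 k, 1 / h (n + 1 + l) ^ 2) :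
    L k * h (n + 1 + k) ^ 3 / 2 * (e * h (n + k + 1) ^ 2) * S ≤ 1 / 20 * (L k * h (n + 1 + k) * h (n + 1) ^ 2 * ε1) := by
  have hpos : ∀ j, 0 < h j := fun j => (hh j).1
  have hanti := (strictAnti_of_memFlow hβ hlo hh hf).antitone
  have hx := hpos (n + 1 + k)
  rw [show n + k + 1 = n + 1 + k by ring]
  -- the level at n+1+k is at least (n+1+k) β₀ ≥ (k−1) β₀
  have hlev : ((n + 1 + k : ℕ) : ℝ) * β₀ ≤ 1 / h (n + 1 + k) ^ 2 := by
    rw [invSq_eq_of_memFlow hf (n + 1 + k)]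
    have := mul_lower_le_drive hlo hh (n + 1 + k)
    have : 0 ≤ 1 / y ^ 2 := by positivity
    linarith
  have hkm1 : ((k : ℝ) - 1) * β₀ ≤ 1 / h (n + 1 + k) ^ 2 := by
    have : ((k : ℝ) - 1) * β₀ ≤ ((n + 1 + k : ℕ) : ℝ) * β₀ := by
      apply mul_le_mul_of_nonneg_right _ hβ.le; push_cast; linarith
    exact this.trans hlev
  -- the window: Σ_{l<k} a_{n+1+l} ≤ (k−1) a_{n+1+k}
  have hwin : ∑ l ∈ Ico 1 k, 1 / h (n + 1 + l) ^ 2 ≤ ((k : ℝ) - 1) * (1 / h (n + 1 + k) ^ 2) := by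
    calc ∑ l ∈ Ico 1 k, 1 / h (n + 1 + l) ^ 2 ≤ ∑ l ∈ Ico 1 k, 1 / h (n + 1 + k) ^ 2 :=
          sum_le_sum fun l hl => one_div_le_one_div_of_le (pow_pos hx 2)
            (pow_le_pow_left₀ hx.le (hanti (by have := (mem_Ico.mp hl).2; omega)) 2)
      _ = ((k : ℝ) - 1) * (1 / h (n + 1 + k) ^ 2) := by
          rw [sum_const, Nat.card_Ico, nsmul_eq_mul]; push_cast [hk]; ring
  have hS' : S ≤ ε1 * h (n + 1) ^ 2 * (((k : ℝ) - 1) * (1 / h (n + 1 + k) ^ 2)) :=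
    hS.trans (mul_le_mul_of_nonneg_left hwin (by positivity))
  have hx2 : 0 < h (n + 1 + k) ^ 2 := pow_pos hx 2
  have hkey : e * (((k : ℝ) - 1) * h (n + 1 + k) ^ 2) ≤ 1 / 10 := by
    have h1 : ((k : ℝ) - 1) * h (n + 1 + k) ^ 2 ≤ 1 / β₀ := by
      rw [le_div_iff₀ hβ]
      have := mul_le_mul_of_nonneg_right hkm1 hx2.le
      rw [one_div_mul_cancel hx2.ne'] at this
      linarith
    calc e * (((k : ℝ) - 1) * h (n + 1 + k) ^ 2) ≤ e * (1 / β₀) := mul_le_mul_of_nonneg_left h1 he0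
      _ ≤ β₀ / 10 * (1 / β₀) := mul_le_mul_of_nonneg_right he (by positivity)
      _ = 1 / 10 := by field_simp
  have hLh : 0 ≤ L k * h (n + 1 + k) := mul_nonneg (hL k) hx.le
  calc L k * h (n + 1 + k) ^ 3 / 2 * (e * h (n + 1 + k) ^ 2) * S
      ≤ L k * h (n + 1 + k) ^ 3 / 2 * (e * h (n + 1 + k) ^ 2) * (ε1 * h (n + 1) ^ 2 * (((k : ℝ) - 1) * (1 / h (n + 1 + k) ^ 2))) := by
        have hLk := hL k
        exact mul_le_mul_of_nonneg_left hS' (by positivity)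
    _ = (L k * h (n + 1 + k) * h (n + 1) ^ 2 * ε1) * (e * (((k : ℝ) - 1) * h (n + 1 + k) ^ 2)) / 2 := by
        have hc : h (n + 1 + k) ^ 2 * (1 / h (n + 1 + k) ^ 2) = 1 := mul_one_div_cancel hx2.ne'
        linear_combination (L k * h (n + 1 + k) ^ 3 / 2 * e * ε1 * h (n + 1) ^ 2 * ((k : ℝ) - 1)) * hc
    _ ≤ (L k * h (n + 1 + k) * h (n + 1) ^ 2 * ε1) * (1 / 10) / 2 := by
        apply div_le_div_of_nonneg_right _ (by norm_num)
        exact mul_le_mul_of_nonneg_left hkey (by positivity)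
    _ = 1 / 20 * (L k * h (n + 1 + k) * h (n + 1) ^ 2 * ε1) := by ring

/-! ## §4 The deep region for the variation bound -/

/-- **THE DEEP REGION, WITH THE FIRST MOMENT SMALL AT THE PIN**: beyond some depth `N₀`, `u_n ≤ 1∕(5(K+1))`, `(Σ_kL_k)·h_n ≤ (3√3∕2)β₀` ((E118c) `exists_base_depth`) AND
`(Σ_{1≤k<K} k·L_k)·h_n ≤ 2β₀` (levels grow at least linearly). [folklore] -/
theorem exists_base_depth_var (hBaff : ∀ u, SeqBox γ u → B u = β₀ + ∑ k ∈ range K, L k * u k) (hL : ∀ k, 0 ≤ L k) (hβ : 0 < β₀)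
    {gIR : ℝ} {h : ℕ → ℝ} (hh : SeqBox γ h) (hf : MemFlow B gIR h) :
    ∃ N₀ : ℕ, ∀ n, N₀ ≤ n →
      ((1 / h (n + 1) ^ 2 - 1 / h n ^ 2) * h (n + 1) ^ 2 ≤ 1 / (5 * ((K : ℝ) + 1))
        ∧ (∑ k ∈ range K, L k) * h n ≤ 3 * Real.sqrt 3 / 2 * β₀)
        ∧ (∑ k ∈ Ico 1 K, (k : ℝ) * L k) * h n ≤ 2 * β₀ := by
  obtain ⟨hmono, hlo, _, _⟩ := affine_facts hBaff hL hβ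
  have hpos : ∀ j, 0 < h j := fun j => (hh j).1
  obtain ⟨N₀, hN₀⟩ := exists_base_depth hBaff hL hβ hh hf
  set M1 : ℝ := ∑ k ∈ Ico 1 K, (k : ℝ) * L k with hM1
  have hM10 : 0 ≤ M1 := sum_nonneg fun k _ => mul_nonneg (Nat.cast_nonneg k) (hL k)
  have hlev : ∀ n : ℕ, (n : ℝ) * β₀ ≤ 1 / h n ^ 2 := by
    intro n
    rw [invSq_eq_of_memFlow hf n]
    have := mul_lower_le_drive hlo hh n
    have : 0 ≤ 1 / gIR ^ 2 := by positivity
    linarith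
  obtain ⟨N2, hN2⟩ := exists_nat_ge (M1 ^ 2 / (4 * β₀ ^ 3) + 1)
  refine ⟨max N₀ N2, fun n hn => ⟨hN₀ n ((le_max_left _ _).trans hn), ?_⟩⟩
  have hn2 : M1 ^ 2 / (4 * β₀ ^ 3) + 1 ≤ (n : ℝ) := by
    have : (N2 : ℝ) ≤ n := by exact_mod_cast (le_max_right N₀ N2).trans hn
    exact hN2.trans this
  have hn0 : (0 : ℝ) < n := by have : (0:ℝ) ≤ M1 ^ 2 / (4 * β₀ ^ 3) := by positivity
                               linarith
  have ha : (n : ℝ) * β₀ ≤ 1 / h n ^ 2 := hlev n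
  have hhn := hpos n
  have hsq : h n ^ 2 ≤ 1 / ((n : ℝ) * β₀) := by
    rw [le_div_iff₀ (by positivity), mul_comm]
    have := mul_le_mul_of_nonneg_right ha (sq_nonneg (h n))
    rwa [one_div_mul_cancel (pow_pos hhn 2).ne'] at this
  have htarget : (M1 * h n) ^ 2 ≤ (2 * β₀) ^ 2 := by
    rw [mul_pow]
    have h1 : M1 ^ 2 * h n ^ 2 ≤ M1 ^ 2 * (1 / ((n : ℝ) * β₀)) := mul_le_mul_of_nonneg_left hsq (sq_nonneg M1)
    have h2 : M1 ^ 2 * (1 / ((n : ℝ) * β₀)) ≤ (2 * β₀) ^ 2 := by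
      rw [mul_one_div, div_le_iff₀ (by positivity)]
      have : M1 ^ 2 ≤ 4 * β₀ ^ 3 * ((n : ℝ) - 1) := by
        have := (div_le_iff₀ (by positivity : (0:ℝ) < 4 * β₀ ^ 3)).mp (by linarith : M1 ^ 2 / (4 * β₀ ^ 3) ≤ (n : ℝ) - 1)
        linarith
      nlinarith [pow_pos hβ 3]
    exact h1.trans h2
  exact (pow_le_pow_iff_left₀ (mul_nonneg hM10 hhn.le) (by positivity) two_ne_zero).1 htarget

/-- **THE VARIATION BOUND HOLDS OUTRIGHT IN THE DEEP REGION.**  Base affine, `B′ ≥ B` with isotone excess and a modulus; base orbit `h = S y`; at a row `m` with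
`(Σ_{1≤k<K} k·L_k)·h_m ≤ 2β₀` and configurations comparing from every pin `h_{m′}`, `m′ ≥ m`:  for every `J`,
`Σ_{j<J} h_{m+j}²·(e_{m+j} − e_{m+j+1}) ≤ X_m·h_m²` — because `X_m ≥ e_m − T(m)·e_{m+1}` ((E119b) `step_ge_excess`) with `T(m) ≤ (Σ_kk·L_k)·h_{m+1}³∕2 ≤ β₀·h_{m+1}² ≤
u_m = 1 − h_{m+1}²∕h_m²`, while the left side is at most `h_m²·Δe_m + h_{m+1}²·e_{m+1} = h_m²·(e_m − u_m·e_{m+1})`. [folklore] -/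
theorem var_base (hBaff : ∀ u, SeqBox γ u → B u = β₀ + ∑ k ∈ range K, L k * u k) (hL : ∀ k, 0 ≤ L k) (hβ : 0 < β₀)
    (hB' : ∀ u u' : ℕ → ℝ, SeqBox γ u → SeqBox γ u' → ∀ D : ℝ, (∀ j, |u j - u' j| ≤ D) → |B' u - B' u'| ≤ M' * D) (hM' : 0 ≤ M')
    (hexc : ∀ u, SeqBox γ u → B u ≤ B' u)
    (hDmono : ∀ u v : ℕ → ℝ, SeqBox γ u → SeqBox γ v → (∀ j, u j ≤ v j) → B' u - B u ≤ B' v - B v)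
    (hS : ∀ p, 0 < p → p ≤ γ → SeqBox γ (S p) ∧ MemFlow B p (S p))
    (huniq : ∀ p, 0 < p → p ≤ γ → ∀ u u' : ℕ → ℝ, SeqBox γ u → SeqBox γ u' → MemFlow B p u → MemFlow B p u' → u = u')
    (hS' : ∀ p, 0 < p → p ≤ γ → SeqBox γ (S' p) ∧ MemFlow B' p (S' p))
    (huniq' : ∀ p, 0 < p → p ≤ γ → ∀ u u' : ℕ → ℝ, SeqBox γ u → SeqBox γ u' → MemFlow B' p u → MemFlow B' p u' → u = u')
    {y : ℝ} (hy : 0 < y) (hyγ : y ≤ γ) (m : ℕ) (hM1 : (∑ k ∈ Ico 1 K, (k : ℝ) * L k) * S y m ≤ 2 * β₀)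
    (hcmp : ∀ m', m ≤ m' → ∀ j, S' (S y m') j ≤ S y (m' + j)) (J : ℕ) :
    ∑ j ∈ range J, S y (m + j) ^ 2
        * ((B' (S' (S y (m + j))) - B (S' (S y (m + j)))) - (B' (S' (S y (m + j + 1))) - B (S' (S y (m + j + 1)))))
      ≤ (B' (S' (S y m)) - B (S (S y m))) * S y m ^ 2 := by
  obtain ⟨hmono, hlo, _, _⟩ := affine_facts hBaff hL hβ
  have hh := (hS y hy hyγ).1
  have hf := (hS y hy hyγ).2
  have hpos : ∀ j, 0 < S y j := fun j => (hh j).1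
  have hanti := (strictAnti_of_memFlow hβ hlo hh hf).antitone
  set e : ℕ → ℝ := fun i => B' (S' (S y i)) - B (S' (S y i)) with he_def
  have he0 : ∀ i, 0 ≤ e i := fun i => by simp only [he_def]; linarith [hexc _ (hS' _ (family_mem hS hy hyγ i).1 (family_mem hS hy hyγ i).2).1]
  have heanti : ∀ i, e (i + 1) ≤ e i := fun i => (excess_orbit_antitone hBaff hL hβ hB' hM' hexc hDmono hS hS' huniq' hy hyγ i).2
  have htel : ∀ J' : ℕ, ∑ j ∈ range J', (e (m + 1 + j) - e (m + 1 + j + 1)) = e (m + 1) - e (m + 1 + J') := by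
    intro J'
    induction J' with
    | zero => simp
    | succ J' ih => rw [sum_range_succ, ih, show m + 1 + (J' + 1) = m + 1 + J' + 1 by ring]; ring
  have hm0 := hpos m; have hm1 := hpos (m + 1)
  have hm2 : 0 < S y m ^ 2 := pow_pos hm0 2
  -- the left side is at most h_m² Δe_m + h_{m+1}² e_{m+1}
  have hlhs : ∑ j ∈ range J, S y (m + j) ^ 2 * (e (m + j) - e (m + j + 1)) ≤ S y m ^ 2 * (e m - e (m + 1)) + S y (m + 1) ^ 2 * e (m + 1) := by
    cases J with
    | zero =>
      simp only [range_zero, sum_empty]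
      have := heanti m; have := he0 (m + 1); positivity
    | succ J' =>
      rw [sum_range_succ']
      simp only [add_zero]
      have hrest : ∑ j ∈ range J', S y (m + (j + 1)) ^ 2 * (e (m + (j + 1)) - e (m + (j + 1) + 1)) ≤ S y (m + 1) ^ 2 * (e (m + 1) - e (m + 1 + J')) := by
        rw [← htel J', mul_sum]
        refine sum_le_sum fun j _ => ?_
        rw [show m + (j + 1) = m + 1 + j by ring]
        have hΔ : 0 ≤ e (m + 1 + j) - e (m + 1 + j + 1) := by linarith [heanti (m + 1 + j)]
        exact mul_le_mul_of_nonneg_right (pow_le_pow_left₀ (hpos _).le (hanti (by omega)) 2) hΔ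
      have : S y (m + 1) ^ 2 * (e (m + 1) - e (m + 1 + J')) ≤ S y (m + 1) ^ 2 * e (m + 1) :=
        mul_le_mul_of_nonneg_left (by linarith [he0 (m + 1 + J')]) (sq_nonneg _)
      linarith
  -- T(m) ≤ M1 h_{m+1}³/2 ≤ β₀ h_{m+1}²
  have hT : ∑ k ∈ Ico 1 K, (k : ℝ) * (L k * S y (m + k) ^ 3 / 2) ≤ β₀ * S y (m + 1) ^ 2 := by
    have h1 : ∑ k ∈ Ico 1 K, (k : ℝ) * (L k * S y (m + k) ^ 3 / 2) ≤ ∑ k ∈ Ico 1 K, (k : ℝ) * L k * (S y (m + 1) ^ 3 / 2) := by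
      refine sum_le_sum fun k hk => ?_
      have hk1 : 1 ≤ k := (mem_Ico.mp hk).1
      have h3 : S y (m + k) ^ 3 ≤ S y (m + 1) ^ 3 := pow_le_pow_left₀ (hpos _).le (hanti (by omega)) 3
      have := mul_le_mul_of_nonneg_left h3 (mul_nonneg (Nat.cast_nonneg k) (hL k))
      nlinarith
    rw [← sum_mul] at h1
    have h2 : (∑ k ∈ Ico 1 K, (k : ℝ) * L k) * (S y (m + 1) ^ 3 / 2) = (∑ k ∈ Ico 1 K, (k : ℝ) * L k) * S y (m + 1) / 2 * S y (m + 1) ^ 2 := by ring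
    have hM1' : (∑ k ∈ Ico 1 K, (k : ℝ) * L k) * S y (m + 1) ≤ 2 * β₀ := by
      have hM10 : 0 ≤ ∑ k ∈ Ico 1 K, (k : ℝ) * L k := sum_nonneg fun k _ => mul_nonneg (Nat.cast_nonneg k) (hL k)
      exact (mul_le_mul_of_nonneg_left (hanti (Nat.le_succ m)) hM10).trans hM1
    rw [h2] at h1
    have h3 : (∑ k ∈ Ico 1 K, (k : ℝ) * L k) * S y (m + 1) / 2 * S y (m + 1) ^ 2 ≤ β₀ * S y (m + 1) ^ 2 := by
      apply mul_le_mul_of_nonneg_right _ (sq_nonneg _); linarith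
    exact h1.trans h3
  -- β₀ h_{m+1}² ≤ u_m = 1 − h_{m+1}²/h_m², in the form h_m² β₀ h_{m+1}² ≤ h_m² − h_{m+1}²
  have hu : S y m ^ 2 * (β₀ * S y (m + 1) ^ 2) ≤ S y m ^ 2 - S y (m + 1) ^ 2 := by
    have hinc : β₀ ≤ 1 / S y (m + 1) ^ 2 - 1 / S y m ^ 2 := by rw [hf.2 m]; linarith [hlo _ (seqBox_shift hh (m + 1))]
    have hm12 : 0 < S y (m + 1) ^ 2 := pow_pos hm1 2
    have hc1 : S y (m + 1) ^ 2 * (1 / S y (m + 1) ^ 2) = 1 := mul_one_div_cancel hm12.ne'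
    have hc2 : S y m ^ 2 * (1 / S y m ^ 2) = 1 := mul_one_div_cancel hm2.ne'
    have hid : S y m ^ 2 - S y (m + 1) ^ 2 = S y m ^ 2 * S y (m + 1) ^ 2 * (1 / S y (m + 1) ^ 2 - 1 / S y m ^ 2) := by
      linear_combination (-(S y m ^ 2)) * hc1 + (S y (m + 1) ^ 2) * hc2
    rw [hid]
    have := mul_le_mul_of_nonneg_left hinc (mul_nonneg hm2.le (sq_nonneg (S y (m + 1))))
    nlinarith
  -- X_m ≥ e_m − T(m) e_{m+1}
  have hX := step_ge_excess hBaff hL hβ hB' hM' hexc hDmono hS huniq hS' huniq' hy hyγ m hcmp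
  have hTe : (∑ k ∈ Ico 1 K, (k : ℝ) * (L k * S y (m + k) ^ 3 / 2)) * e (m + 1) ≤ β₀ * S y (m + 1) ^ 2 * e (m + 1) :=
    mul_le_mul_of_nonneg_right hT (he0 (m + 1))
  have hfin : S y m ^ 2 * (e m - e (m + 1)) + S y (m + 1) ^ 2 * e (m + 1)
      ≤ (e m - β₀ * S y (m + 1) ^ 2 * e (m + 1)) * S y m ^ 2 := by
    have := mul_le_mul_of_nonneg_right hu (he0 (m + 1))
    nlinarith
  have hX' : (e m - β₀ * S y (m + 1) ^ 2 * e (m + 1)) * S y m ^ 2 ≤ (B' (S' (S y m)) - B (S (S y m))) * S y m ^ 2 := by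
    apply mul_le_mul_of_nonneg_right _ hm2.le
    simp only [he_def] at hTe ⊢
    linarith
  exact hlhs.trans (hfin.trans hX')

end Summit.QuantumFields.BalabanUV.Beta.EriceRemainderEnclosureHistoryAutonomyComparisonNonlinearVariationBase

end
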